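import Summits.BirchSwinnertonDyer.Rank1Residual.Additive.SignedTwistTraceDictionary
import Mathlib.RingTheory.IntegralDomain
import HarnessLib

/-!
# (P5-2c) The local points dictionary of the signed-`η` twist, II: `E⁻_V(K₀ℚ_n·E)^{η} → E^{−,str}_W(n)`
# with the finding `2 • Tr_{n/0} = 0` (D4b2), the ZERO clause (D4b2′), and the η-AVERAGE (D4b3)
# (`cells/n1011/skel/T-O7ss-P5.md` §2 (D4b))
(cell `b2b-bsdres`, team n1011, seat n1011-p17 GEN 7; row T-O7ss-P13 follow-up (P5), file P5-2c;
designs (A)(B) APPROVED by referee-1 GEN 22)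

HONEST FRAMING (cell `b2b-bsdres`, run/shared/lean/b2b/bsd-rank1-residual/, verbatim in every
file): the goal of the cell is to DELETE the COMBINATION-SHAPED residual classes of the
Birch–Swinnerton-Dyer formula for ALL analytic-rank `≤ 1` elliptic curves over `ℚ` — "full BSD
formula for every rank `≤ 1` curve in class `C`" assembled STRICTLY from published theorems — so
that the rank-`≤ 1` remainder becomes exactly the CONSTRUCTION-SHAPED classes, which are TYPED
(missing-input `Prop`s), NOT attempted. This is not "finishing BSD". Research route on
O7-ss ∩ (G)∧ss ∩ e = 2 (OPEN) / X4 CONSTRUCTION-SHAPED; nothing here is booked; no label moves.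
TOOL THEOREMS ONLY: no definition, no named Literature fact, no `sorry`; axioms standard.


FINDING (referee-1 GEN 22 hand-check (c)): at the level of POINTS,
`Ψ⁻¹(E⁻_V(K_n)^{η-eigen}) = {P ∈ E⁻_W(ℚ_n) | 2 • Tr_{n/0} P = 0}`, strictly between the ZERO clause
and p17 F2a's TORSION clause; the η-average (D4b3) is what the `⊇` half of the Selmer dictionary
(P5-4) and the Kummer dictionary (P5-3) consume. Binders as in P5-2b (+ `[(galRange K₀).Normal]` for
(D4b3), as cc-typer-6's tower instances want).

## What is proved
* `localTransport_symm_mem_signed_of_eigen` ((D4b2), Def. 1.1 part), **`localTransport_symm_mem_strictSigned_of_eigen`**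
  ((D4b2): strict group + `2 • Tr^W_{n/0} = 0`), `localTransport_symm_mem_signed_of_eigen_of_trace_eq_zero`
  ((D4b2′): ZERO clause), `galSmul_zsmul`, **`localPairTrace_localTransport_symm_mem_signed`** ((D4b3):
  for ANY `S ∈ E⁻_V(K_n)`, `Tr_{K_n·E/ℚ_n·E}(Ψ⁻¹S) ∈ E^{−,0}_W(n)`; `∑_δ η(δ) = 0` by `sum_hom_units_eq_zero`).

References: S. Kobayashi, Invent. Math. 152 (2003) §2 p. 4, Def. 2.1, §4 p. 8 [Kobayashi2003].
-/

noncomputable section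

open scoped Classical

open WeierstrassCurve Field

namespace Summit.BirchSwinnertonDyer.Rank1Residual.Additive.SignedTwist

open Literature.NumberTheory.EllipticCurves Literature.NumberTheory.GaloisRepresentations
  Literature.NumberTheory.EllipticCurves.Kobayashi2003
  Summit.BirchSwinnertonDyer.Rank1Residual.AdditivePotMult

/-! ## §7 (D4b2)(D4b3): back from `E⁻_V(K₀ℚ_n·E)^η` to the strict `W`-side group; the η-average -/

section PointsDictionary2

open ZpExtension

variable (W : WeierstrassCurve ℚ) (K₀ : Type) [Field K₀] [NumberField K₀] {θ : K₀} {c : ℚ}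
  (hθ : θ ∉ Set.range (algebraMap ℚ K₀)) (hc : θ ^ 2 = algebraMap ℚ K₀ c)
  {p : ℕ} [Fact p.Prime] (κ : ZpExtension ℚ p)
  {V : WeierstrassCurve ℚ} {C : VariableChange ℚ} (hCV : C • W.quadraticTwist c = V)
  {E : Type} [Field E] [Algebra ℚ E] (ι : AlgebraicClosure ℚ →ₐ[ℚ] AlgebraicClosure E)
  (η : absoluteGaloisGroup ℚ →* ℤˣ)
  (hη : ∀ σ : absoluteGaloisGroup ℚ, η σ = 1 ↔ σ • rootInClosure K₀ θ = rootInClosure K₀ θ)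

include hη in
/-- **(D4b2, Def. 1.1 part) `E⁻_V(K_n)^{η} → E⁻_W(n)`**: an `η`-eigen point of cc-typer-6's minus
group pulls back into Kobayashi's Def. 1.1 minus group in `W`-coordinates: its traces
`Tr^W_{n/m+1}`, `m` odd, are fixed by `Gal(ℚ̄_E/K₀ℚ_m·E)` (dictionary (D4a)) and by
`Gal(ℚ̄_E/ℚ_∞·E)` (they lie in layer `m+1`), hence by `Gal(ℚ̄_E/ℚ_m·E)` ((D0)(i)).
[cite: Kobayashi2003, §2 p. 4, Def. 1.1] -/
theorem localTransport_symm_mem_signed_of_eigen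
    (hD : ∀ g : absoluteGaloisGroup ℚ, ∃ τ : absoluteGaloisGroup E,
      (resGalOfEmb ι τ)⁻¹ * g ∈ towerTopSubgroup κ K₀)
    (hκ₀ : ∀ x, ∃ g ∈ galRange (K := ℚ) K₀, κ g = x) {n : ℕ} {S : localPoints V E}
    (hS : S ∈ towerSignedLocalPointsOfEmb (towerSubgroup κ K₀) ι V (-1) n)
    (hSη : ∀ τ ∈ localLayerSubgroupOfEmb κ ι n,
      τ • S = ((η (resGalOfEmb ι τ) : ℤˣ) : ℤ) • S) :
    (localTransport W K₀ hθ hc hCV E ι).symm S ∈ signedLocalPointsOfEmb κ ι W (-1) n := by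
  set Q := (localTransport W K₀ hθ hc hCV E ι).symm S with hQ
  have hQn : Q ∈ localLayerPointsOfEmb κ ι W n :=
    localTransport_symm_mem_localLayerPointsOfEmb W K₀ hθ hc κ hCV ι η hη hSη
  have hΨQ : localTransport W K₀ hθ hc hCV E ι Q = S := AddEquiv.apply_symm_apply _ _
  obtain ⟨-, hSodd, -⟩ := (mem_towerSignedLocalPointsOfEmb_iff _ ι V (-1) n S).mp hS
  refine (mem_signedLocalPointsOfEmb_iff κ ι W (-1) n Q).mpr ⟨hQn, fun m hm hε ↦ ?_⟩
  set R := localTraceOfEmb κ ι W (m + 1) n Q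
  have hRV : localTransport W K₀ hθ hc hCV E ι R ∈
      localFixedPointsOfEmb ι V (towerSubgroup κ K₀ m) := by
    rw [localTransport_localTraceOfEmb W K₀ hθ hc κ hCV ι hD hκ₀ (m + 1) n hQn, hΨQ]
    exact hSodd m hm hε
  have hRU : R ∈ localFixedPointsOfEmb ι W (towerSubgroup κ K₀ m) := by
    have h := localTransport_symm_mem_localFixedPointsOfEmb W K₀ hθ hc hCV ι
      (towerSubgroup_le_galRange κ K₀ m) hRV
    rwa [AddEquiv.symm_apply_apply] at h
  exact mem_localLayerPointsOfEmb_of_tower_of_ker W K₀ κ ι hD hκ₀ hRU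
    (mem_localFixedPointsOfEmb_ker_of_mem_layer W κ ι (localTraceOfEmb_mem_of_mem κ ι W (m + 1) n hQn))

include hη in
/-- **(D4b2) `E⁻_V(K_n)^{η} → E^{−,str}_W(n)`, with the FINDING `2 • Tr_{n/0} = 0`**: the
`m = −1` clause `Tr^V_{n/0} S ∈ V(E)` pulls back to `2 • Tr^W_{n/0}(Ψ⁻¹S) = 0` — `Ψ(Tr^W_{n/0} Q)`
is `Γ_E`-fixed while an element of `Gal(ℚ̄_E/ℚ_∞·E)` with `η = −1` ((D0)(iii)) negates it — in
particular p17's TORSION clause holds. [cite: Kobayashi2003, §2 p. 4, Def. 2.1 (the clause m = −1)] -/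
theorem localTransport_symm_mem_strictSigned_of_eigen
    (hD : ∀ g : absoluteGaloisGroup ℚ, ∃ τ : absoluteGaloisGroup E,
      (resGalOfEmb ι τ)⁻¹ * g ∈ towerTopSubgroup κ K₀)
    (hκ₀ : ∀ x, ∃ g ∈ galRange (K := ℚ) K₀, κ g = x) {n : ℕ} {S : localPoints V E}
    (hS : S ∈ towerSignedLocalPointsOfEmb (towerSubgroup κ K₀) ι V (-1) n)
    (hSη : ∀ τ ∈ localLayerSubgroupOfEmb κ ι n,
      τ • S = ((η (resGalOfEmb ι τ) : ℤˣ) : ℤ) • S) :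
    (localTransport W K₀ hθ hc hCV E ι).symm S ∈ strictSignedLocalPointsOfEmb κ ι W (-1) n ∧
      2 • localTraceOfEmb κ ι W 0 n ((localTransport W K₀ hθ hc hCV E ι).symm S) = 0 := by
  set Q := (localTransport W K₀ hθ hc hCV E ι).symm S with hQ
  have hQs := localTransport_symm_mem_signed_of_eigen W K₀ hθ hc κ hCV ι η hη hD hκ₀ hS hSη
  have hQn : Q ∈ localLayerPointsOfEmb κ ι W n := signedLocalPointsOfEmb_le κ ι W (-1) n hQs
  have hΨQ : localTransport W K₀ hθ hc hCV E ι Q = S := AddEquiv.apply_symm_apply _ _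
  set T := localTraceOfEmb κ ι W 0 n Q
  -- `Ψ T = Tr^V_{n/0} S` is fixed by all of `Γ_E` (the `m = −1` clause), and `T ∈ W(E)` too
  have hΨT : ∀ τ : absoluteGaloisGroup E, τ • localTransport W K₀ hθ hc hCV E ι T =
      localTransport W K₀ hθ hc hCV E ι T := by
    rw [← mem_localFixedPointsOfEmb_top_iff ι V,
      localTransport_localTraceOfEmb W K₀ hθ hc κ hCV ι hD hκ₀ 0 n hQn, hΨQ]
    exact ((mem_towerSignedLocalPointsOfEmb_iff _ ι V (-1) n S).mp hS).2.2 rfl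
  have hT : ∀ τ : absoluteGaloisGroup E, τ • T = T :=
    (mem_localLayerPointsOfEmb_zero_iff κ ι W T).mp (localTraceOfEmb_mem_of_mem κ ι W 0 n hQn)
  -- an element over `ℚ_∞` with `η = −1` negates `Ψ T`
  obtain ⟨τ, -, hτ⟩ :=
    exists_mem_localSubgroupOfEmb_ker_eta_eq_neg_one κ K₀ ι hθ hc η hη hD hκ₀
  have h2T : 2 • T = 0 := by
    have h := localTransport_smul W K₀ hθ hc hCV E ι η hη τ T
    rw [hT τ, hτ, Units.val_neg, Units.val_one, neg_one_zsmul, hΨT τ, eq_neg_iff_add_eq_zero,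
      ← two_nsmul, ← map_nsmul, AddEquiv.map_eq_zero_iff] at h
    exact h
  refine ⟨(mem_strictSignedLocalPointsOfEmb_iff κ ι W (-1) n Q).mpr ⟨hQs, fun _ ↦ ?_⟩, h2T⟩
  rw [AddCommGroup.mem_torsion, isOfFinAddOrder_iff_nsmul_eq_zero]
  exact ⟨2, two_pos, h2T⟩

include hη in
/-- **(D4b2′)**: if moreover `Tr^V_{n/0} S = 0`, then `Tr^W_{n/0}(Ψ⁻¹ S) = 0` (the ZERO clause).
[cite: Kobayashi2003, §2 p. 4] -/
theorem localTransport_symm_mem_signed_of_eigen_of_trace_eq_zero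
    (hD : ∀ g : absoluteGaloisGroup ℚ, ∃ τ : absoluteGaloisGroup E,
      (resGalOfEmb ι τ)⁻¹ * g ∈ towerTopSubgroup κ K₀)
    (hκ₀ : ∀ x, ∃ g ∈ galRange (K := ℚ) K₀, κ g = x) {n : ℕ} {S : localPoints V E}
    (hS : S ∈ towerSignedLocalPointsOfEmb (towerSubgroup κ K₀) ι V (-1) n)
    (hSη : ∀ τ ∈ localLayerSubgroupOfEmb κ ι n,
      τ • S = ((η (resGalOfEmb ι τ) : ℤˣ) : ℤ) • S)
    (hS0 : localPairTraceOfEmb ι V (towerSubgroup κ K₀ 0) (towerSubgroup κ K₀ n) S = 0) :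
    (localTransport W K₀ hθ hc hCV E ι).symm S ∈ signedLocalPointsOfEmb κ ι W (-1) n ∧
      localTraceOfEmb κ ι W 0 n ((localTransport W K₀ hθ hc hCV E ι).symm S) = 0 := by
  have hQs := localTransport_symm_mem_signed_of_eigen W K₀ hθ hc κ hCV ι η hη hD hκ₀ hS hSη
  have hQn := signedLocalPointsOfEmb_le κ ι W (-1) n hQs
  refine ⟨hQs, ?_⟩
  rw [← (localTransport W K₀ hθ hc hCV E ι).map_eq_zero_iff,
    localTransport_localTraceOfEmb W K₀ hθ hc κ hCV ι hD hκ₀ 0 n hQn, AddEquiv.apply_symm_apply, hS0]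

omit [Algebra ℚ E] in
/-- The Galois action commutes with `ℤ`-multiples (it is by additive maps). [folklore] -/
theorem galSmul_zsmul {A : Type*} [AddCommGroup A] [DistribMulAction (absoluteGaloisGroup E) A]
    (τ : absoluteGaloisGroup E) (k : ℤ) (a : A) : τ • (k • a) = k • (τ • a) :=
  map_zsmul (DistribSMul.toAddMonoidHom A τ) k a

include hθ hc hη in
/-- **(D4b3) the η-AVERAGE**: for ANY `S ∈ E⁻_V(K₀ℚ_n·E)` (no eigen-condition) the `W`-side pair
trace `P_η := Tr_{K₀ℚ_n·E / ℚ_n·E}(Ψ⁻¹ S)` lies in Kobayashi's Def. 1.1 minus group of `W` with the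
ZERO clause `Tr^W_{n/0} P_η = 0`: `Ψ P_η = S_η := ∑_{δ} η(δ) δ̃ • S` is an `η`-eigen element of
`E⁻_V(K₀ℚ_n·E)` (Γ_E-stability), and `Tr^V_{n/0} S_η = (∑_δ η(δ)) • Tr^V_{n/0} S = 0` because
`η ∘ res` is a NON-TRIVIAL character of `Gal(K₀ℚ_n·E/ℚ_n·E)` ((D0)(iii); `sum_hom_units_eq_zero`);
conclude by (D4b2′). This is the local input of the `⊇` half of the Selmer dictionary (P5-4).
[cite: Kobayashi2003, §2 p. 4, §4 p. 8 (ε_η = (1/♯Δ) ∑ η⁻¹(τ) τ)] -/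
theorem localPairTrace_localTransport_symm_mem_signed
    (hD : ∀ g : absoluteGaloisGroup ℚ, ∃ τ : absoluteGaloisGroup E,
      (resGalOfEmb ι τ)⁻¹ * g ∈ towerTopSubgroup κ K₀)
    (hκ₀ : ∀ x, ∃ g ∈ galRange (K := ℚ) K₀, κ g = x) [(galRange (K := ℚ) K₀).Normal]
    {n : ℕ} {S : localPoints V E}
    (hS : S ∈ towerSignedLocalPointsOfEmb (towerSubgroup κ K₀) ι V (-1) n) :
    localPairTraceOfEmb ι W (κ.layerSubgroup n) (towerSubgroup κ K₀ n)
        ((localTransport W K₀ hθ hc hCV E ι).symm S) ∈ signedLocalPointsOfEmb κ ι W (-1) n ∧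
      localTraceOfEmb κ ι W 0 n (localPairTraceOfEmb ι W (κ.layerSubgroup n) (towerSubgroup κ K₀ n)
        ((localTransport W K₀ hθ hc hCV E ι).symm S)) = 0 := by
  classical
  obtain ⟨hSn, -, hS0⟩ := (mem_towerSignedLocalPointsOfEmb_iff _ ι V (-1) n S).mp hS
  have hTS : ∀ τ : absoluteGaloisGroup E,
      τ • localPairTraceOfEmb ι V (towerSubgroup κ K₀ 0) (towerSubgroup κ K₀ n) S =
        localPairTraceOfEmb ι V (towerSubgroup κ K₀ 0) (towerSubgroup κ K₀ n) S :=
    (mem_localFixedPointsOfEmb_top_iff ι V _).mp (hS0 rfl)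
  set Ψ := localTransport W K₀ hθ hc hCV E ι with hΨ
  set Q := Ψ.symm S with hQdef
  -- the local Galois group `Gal(K₀ℚ_n·E / ℚ_n·E) = A ⧸ N` and the character `χ = η ∘ res` on it
  set A := localLayerSubgroupOfEmb κ ι n with hA
  haveI hUn : (localSubgroupOfEmb (towerSubgroup κ K₀ n) ι).Normal := Subgroup.normal_comap _
  set N := (localSubgroupOfEmb (towerSubgroup κ K₀ n) ι).subgroupOf A with hN
  haveI : Fintype (A ⧸ N) := Fintype.ofFinite _
  let χA : A →* ℤˣ := (η.comp (resGalOfEmb ι).toMonoidHom).comp A.subtype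
  have hχA : ∀ a : A, χA a = η (resGalOfEmb ι (a : absoluteGaloisGroup E)) := fun a ↦ rfl
  have hχN : N ≤ χA.ker := fun u hu ↦ by
    rw [MonoidHom.mem_ker, hχA]
    exact (hη _).mpr (apply_rootInClosure_of_mem K₀ (towerSubgroup_le_galRange κ K₀ n
      ((mem_localSubgroupOfEmb_iff _ ι _).mp (Subgroup.mem_subgroupOf.mp hu))))
  let χ : A ⧸ N →* ℤˣ := QuotientGroup.lift N χA hχN
  have hχ : ∀ a : A, χ (QuotientGroup.mk a) = η (resGalOfEmb ι (a : absoluteGaloisGroup E)) :=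
    fun a ↦ QuotientGroup.lift_mk' N hχN a
  have hχout : ∀ q : A ⧸ N, χ q = η (resGalOfEmb ι ((q.out : A) : absoluteGaloisGroup E)) := fun q ↦ by
    conv_lhs => rw [← QuotientGroup.out_eq' q]
    exact hχ _
  -- the η-average `S_η`
  set Sη : localPoints V E :=
    ∑ q : A ⧸ N, ((χ q : ℤˣ) : ℤ) • (((q.out : A) : absoluteGaloisGroup E) • S) with hSη
  -- `Ψ P_η = S_η`
  have hΨP : Ψ (localPairTraceOfEmb ι W (κ.layerSubgroup n) (towerSubgroup κ K₀ n) Q) = Sη := by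
    rw [localPairTraceOfEmb_apply, map_sum]
    refine Finset.sum_congr rfl fun q _ ↦ ?_
    rw [hΨ, localTransport_smul W K₀ hθ hc hCV E ι η hη, ← hΨ, hQdef, AddEquiv.apply_symm_apply,
      hχout]
  -- (a) `S_η ∈ E⁻_V(K₀ℚ_n·E)`
  have hSη_mem : Sη ∈ towerSignedLocalPointsOfEmb (towerSubgroup κ K₀) ι V (-1) n :=
    AddSubgroup.sum_mem _ fun q _ ↦ AddSubgroup.zsmul_mem _
      (smul_mem_towerSignedLocalPointsOfEmb ι V (towerSubgroup κ K₀) (-1) n _ hS) _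
  -- (b) `S_η` is `η`-eigen under `A = Gal(ℚ̄_E/ℚ_n·E)`
  have hSη_eigen : ∀ τ ∈ localLayerSubgroupOfEmb κ ι n,
      τ • Sη = ((η (resGalOfEmb ι τ) : ℤˣ) : ℤ) • Sη := by
    intro τ hτ
    set g : A ⧸ N := QuotientGroup.mk ⟨τ, hτ⟩ with hg
    have hperm : ∀ q : A ⧸ N, g * q = QuotientGroup.mk (s := N) (⟨τ, hτ⟩ * q.out) := fun q ↦ by
      conv_lhs => rw [← QuotientGroup.out_eq' q]
      exact (QuotientGroup.mk_mul N _ _).symm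
    -- the summand transforms by `η(res τ)` and the index by `q ↦ g * q`
    have hterm : ∀ q : A ⧸ N,
        τ • (((χ q : ℤˣ) : ℤ) • (((q.out : A) : absoluteGaloisGroup E) • S)) =
          ((η (resGalOfEmb ι τ) : ℤˣ) : ℤ) •
            (((χ (g * q) : ℤˣ) : ℤ) • ((((g * q).out : A) : absoluteGaloisGroup E) • S)) := by
      intro q
      rw [galSmul_zsmul, smul_smul, hperm, out_smul_eq_of_mem_localFixedPointsOfEmb ι V hSn,
        Subgroup.coe_mul, smul_smul (((η (resGalOfEmb ι τ) : ℤˣ) : ℤ)), ← Units.val_mul, hχ,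
        Subgroup.coe_mul, map_mul, map_mul, ← mul_assoc, Int.units_mul_self, one_mul, hχout]
    rw [hSη, Finset.smul_sum, Finset.smul_sum]
    simp_rw [hterm]
    exact Fintype.sum_equiv (Equiv.mulLeft g) _ _ fun q ↦ rfl
  -- (c) `Tr^V_{n/0} S_η = (∑ χ) • Tr^V_{n/0} S = 0`
  have hSη0 : localPairTraceOfEmb ι V (towerSubgroup κ K₀ 0) (towerSubgroup κ K₀ n) Sη = 0 := by
    have hsum : ∑ q : A ⧸ N, ((χ q : ℤˣ) : ℤ) = 0 := by
      obtain ⟨τm, hτmmem, hτm⟩ :=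
        exists_mem_localSubgroupOfEmb_ker_eta_eq_neg_one κ K₀ ι hθ hc η hη hD hκ₀
      have hτmA : τm ∈ A := Subgroup.comap_mono (κ.kerSubgroup_le_layerSubgroup n) hτmmem
      have hf : (Units.coeHom ℤ).comp χ ≠ 1 := fun h ↦ by
        have h1 := DFunLike.congr_fun h (QuotientGroup.mk (⟨τm, hτmA⟩ : A))
        rw [MonoidHom.comp_apply, hχ, MonoidHom.one_apply, Units.coeHom_apply] at h1
        rw [hτm] at h1
        exact absurd h1 (by decide)
      simpa using sum_hom_units_eq_zero ((Units.coeHom ℤ).comp χ) hf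
    rw [hSη, map_sum]
    simp_rw [map_zsmul, localPairTraceOfEmb_smul ι V _ hSn, hTS, ← Finset.sum_smul, hsum, zero_smul]
  -- conclude by (D4b2′) applied to `S_η`, and `Ψ⁻¹ S_η = P_η`
  have hPη : localPairTraceOfEmb ι W (κ.layerSubgroup n) (towerSubgroup κ K₀ n) Q = Ψ.symm Sη := by
    rw [AddEquiv.eq_symm_apply]; exact hΨP
  rw [hPη]
  exact localTransport_symm_mem_signed_of_eigen_of_trace_eq_zero W K₀ hθ hc κ hCV ι η hη hD hκ₀
    hSη_mem hSη_eigen hSη0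

end PointsDictionary2


end Summit.BirchSwinnertonDyer.Rank1Residual.Additive.SignedTwist
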